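import Mathlib.Analysis.Calculus.BumpFunction.Normed
import Mathlib.Analysis.Convolution
import Literature.Analysis.FunctionSpaces.SobolevDomain
import HarnessLib

/-!
# The DiPerna–Lions commutator lemma (named fact, `L²–W^{1,2}` local form on `ℝ³`)

Analysis/FunctionSpaces statement file: ONE named fact (no proof here), the commutator lemma of
DiPerna–Lions 1989, Lemma II.1, in the case `p = p′ = 2`, three space dimensions, local form, with the
standard mollifier realised by Mathlib's normalised bumps of a FIXED SHAPE (outer radius = 2 × inner
radius, so that the kernels are exact rescalings `ε⁻³ρ(·/ε)` of one smooth compactly supported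
nonnegative unit-mass kernel `ρ`, as in the source).

Statement (DiPerna–Lions 1989, §II.1, Lemma II.1; cf. Ambrosio–Crippa 2008, Prop. 25): for
`W ∈ W^{1,2}_loc(ℝ³; ℝ³)` and `η ∈ L²_loc(ℝ³)` the commutator
`s_ε := (W·∇)(ρ_ε ⋆ η) − ρ_ε ⋆ ((W·∇)η)`, where `(W·∇)η := div(Wη) − η div W ∈ 𝒟′`, tends to `0`
in `L¹_loc` as `ε → 0`.  Unpacked against the kernel (all three terms are honest integrals since
`Wη, η div W ∈ L¹_loc`):
`s_ε(x) = ∫ η(y) Dρ_ε(x − y)[W(x) − W(y)] dy + (ρ_ε ⋆ (η · tr DW))(x)`.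

* `Literature.Analysis.FunctionSpaces.DiPernaLionsCommutatorL2` — the named fact.

-- TODO(general form): `W ∈ W^{1,p′}_loc`, `η ∈ L^p_loc`, `1/p + 1/p′ ≤ 1`, any dimension, any fixed
-- kernel `ρ ∈ C_c^∞`, `ρ ≥ 0`, `∫ρ = 1`; convergence in `L^α_loc`, `1/α = 1/p + 1/p′` (as printed).

Consumer: the weak-stratum line `weak_axisym` of crux `PowerGaugeEulerLiouville` (NavierStokesRegularity,
stmt-19832), stub `stub_etaRenormalisation` (renormalisation of the damped Casimir law), file
`Summits/…/Theorems/EulerZoomLiouvillePowerGaugeEulerLiouvilleWeakEtaRenormalisationMember.lean`.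

## References

* R. J. DiPerna, P.-L. Lions, *Ordinary differential equations, transport theory and Sobolev
  spaces*, Invent. Math. 98 (1989), 511–547, §II.1, Lemma II.1. [`DiPernaLions1989Invent`]
* L. Ambrosio, G. Crippa, *Existence, uniqueness, stability and differentiability properties of the
  flow associated to weakly differentiable vector fields*, Lecture Notes UMI 5 (2008), Prop. 25.
-/

noncomputable section

open _root_.MeasureTheory _root_.TopologicalSpace Set Filter Metric Function ContinuousLinearMap
open scoped _root_.Topology ENNReal Convolution

namespace Literature.Analysis.FunctionSpaces

/-- **The DiPerna–Lions commutator lemma, `L²–W^{1,2}` local form on `ℝ³`** (DiPerna–Lions 1989,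
Lemma II.1 with `p = p′ = 2`).  Let `W : ℝ³ → ℝ³` have a whole-space weak gradient `DW` with `W, DW ∈ L²`
of every ball, let `η ∈ L²` of every ball, and let `φₙ` be bumps centred at `0` of fixed shape
(`rOut = 2·rIn`, so the normalised kernels `φ̃ₙ = φₙ.normed` are rescalings of one kernel) with
`rOut → 0`.  Then the commutator `sₙ = (W·∇)(φ̃ₙ ⋆ η) − φ̃ₙ ⋆ ((W·∇)η)`,
`(W·∇)η := div(Wη) − η·tr DW ∈ 𝒟′`, i.e.
`sₙ(x) = ∫ η(y) Dφ̃ₙ(x − y)[W(x) − W(y)] dy + (φ̃ₙ ⋆ (η·tr DW))(x)`,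
converges to `0` in `L¹(B(0,R))` for every `R`.
-- TODO(general form): exponents `p, p′` with `1/p + 1/p′ ≤ 1`, any dimension, any fixed kernel.
[cite: DiPernaLions1989Invent, Lemma II.1] -/
def DiPernaLionsCommutatorL2 : Prop :=
  ∀ (W : EuclideanSpace ℝ (Fin 3) → EuclideanSpace ℝ (Fin 3))
    (DW : EuclideanSpace ℝ (Fin 3) → EuclideanSpace ℝ (Fin 3) →L[ℝ] EuclideanSpace ℝ (Fin 3))
    (η : EuclideanSpace ℝ (Fin 3) → ℝ),
    HasWeakFDerivOn (⊤ : Opens (EuclideanSpace ℝ (Fin 3))) volume W DW →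
    (∀ r : ℝ, MemLp W 2 (volume.restrict (ball (0 : EuclideanSpace ℝ (Fin 3)) r))) →
    (∀ r : ℝ, MemLp DW 2 (volume.restrict (ball (0 : EuclideanSpace ℝ (Fin 3)) r))) →
    (∀ r : ℝ, MemLp η 2 (volume.restrict (ball (0 : EuclideanSpace ℝ (Fin 3)) r))) →
    ∀ φ : ℕ → ContDiffBump (0 : EuclideanSpace ℝ (Fin 3)),
      Tendsto (fun n => (φ n).rOut) atTop (𝓝 0) → (∀ n, (φ n).rOut = 2 * (φ n).rIn) →
      ∀ R : ℝ, Tendsto (fun n => ∫⁻ x in ball (0 : EuclideanSpace ℝ (Fin 3)) R,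
        ‖(∫ y, η y * fderiv ℝ ((φ n).normed volume) (x - y) (W x - W y)) +
          ((φ n).normed volume ⋆[lsmul ℝ ℝ, volume] fun y =>
            η y * LinearMap.trace ℝ (EuclideanSpace ℝ (Fin 3))
              (DW y : EuclideanSpace ℝ (Fin 3) →ₗ[ℝ] EuclideanSpace ℝ (Fin 3))) x‖ₑ) atTop (𝓝 0)

end Literature.Analysis.FunctionSpaces

end
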